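import Mathlib.Analysis.SpecialFunctions.Complex.LogDeriv
import Mathlib.Analysis.SpecialFunctions.Complex.Arg
import Mathlib.RingTheory.Algebraic.Integral
import Literature.NumberTheory.Transcendental.KZDilationLogGenerators
import Literature.NumberTheory.Transcendental.KZSemialgebraicComplex
import HarnessLib

/-!
# The complex Baker sector of the dilation pencil, I: complexification of a real pole pair

Calculus of ONE complex pole of a real one-variable integrand, written in real terms. A pole
`α ∈ ℂ ∖ [a,b]` of a real rational integrand is recorded by the real algebraic numbers `p, q` with
`1/α = p + iq`; the complex affine function
  `w(x) := 1 − (p + iq)·x = (1 − p x) − i q x`   (`x` real)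
has `log w` as primitive of `−(p+iq)/w`, squared modulus `m(x) = (1 − p x)² + (q x)²`, and
  `Re((γ + iδ) · (−(p+iq)/w(x))) = (γ(−p + (p² + q²)x) + δ q)/m(x)`,
the general real simple-pole term (residue `c = γ + iδ`). Collected here: `w ∈ ℂ ∖ ℝ_{≤0}` from the
real condition `0 < 1 − p x ∨ q x ≠ 0`; derivatives of `log w`, `Re(c log w)` and `arg w`; values at
`x = 0`; algebraicity of `w(1)`; `log (conj w) = conj (log w)`; and the Nash data of the squared
modulus `m` (positivity, derivative `2(−p + (p²+q²)x)`, semialgebraicity). Consumed by the complex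
Baker sector of crux `DilationLiftAtOne` (route `KontsevichZagierPeriods/LiftingCriteria`).

Everything is proved; no `def`, no named fact.

## References
* M. Kontsevich, D. Zagier, *Periods* (2001), §1.2. [`KontsevichZagier2001`]
-/

noncomputable section

open Set Filter MvPolynomial Complex
open scoped BigOperators Topology Real ComplexConjugate
open Literature.ModelTheory.ExponentialFields

namespace Literature.NumberTheory.Transcendental

namespace KZ.BakerSectorComplex

variable {p q : ℝ}

/-! ### The complex affine function `w(x) = 1 − (p + iq)x` -/

/-- Real part of `w(x)`. [folklore] -/
@[simp] theorem w_re (p q x : ℝ) : ((1 : ℂ) - ((p : ℂ) + (q : ℂ) * I) * (x : ℂ)).re = 1 - p * x := by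
  simp

/-- Imaginary part of `w(x)`. [folklore] -/
@[simp] theorem w_im (p q x : ℝ) : ((1 : ℂ) - ((p : ℂ) + (q : ℂ) * I) * (x : ℂ)).im = -(q * x) := by
  simp

/-- `w(x) ∉ ℝ_{≤0}` from the real condition `0 < 1 − p x ∨ q x ≠ 0`. [folklore] -/
theorem w_mem_slitPlane {x : ℝ} (h : 0 < 1 - p * x ∨ q * x ≠ 0) :
    (1 : ℂ) - ((p : ℂ) + (q : ℂ) * I) * (x : ℂ) ∈ slitPlane := by
  rcases h with h | h
  · exact Or.inl (by simpa using h)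
  · exact Or.inr (by simpa using h)

/-- `w(x) ≠ 0`. [folklore] -/
theorem w_ne_zero {x : ℝ} (h : 0 < 1 - p * x ∨ q * x ≠ 0) :
    (1 : ℂ) - ((p : ℂ) + (q : ℂ) * I) * (x : ℂ) ≠ 0 :=
  (mem_slitPlane_iff_arg.mp (w_mem_slitPlane h)).2

/-- `|w(x)|² = m(x) = (1 − p x)² + (q x)²`. [folklore] -/
theorem normSq_w (p q x : ℝ) :
    Complex.normSq ((1 : ℂ) - ((p : ℂ) + (q : ℂ) * I) * (x : ℂ)) = (1 - p * x) ^ 2 + (q * x) ^ 2 := by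
  rw [Complex.normSq_apply, w_re, w_im]; ring

/-- The squared modulus is positive under the slit condition. [folklore] -/
theorem m_pos {x : ℝ} (h : 0 < 1 - p * x ∨ q * x ≠ 0) : 0 < (1 - p * x) ^ 2 + (q * x) ^ 2 := by
  rw [← normSq_w]; exact Complex.normSq_pos.mpr (w_ne_zero h)

/-- `w(0) = 1`. [folklore] -/
@[simp] theorem w_zero (p q : ℝ) : (1 : ℂ) - ((p : ℂ) + (q : ℂ) * I) * ((0:ℝ) : ℂ) = 1 := by simp

/-- `w` is differentiable in the real variable with derivative `−(p + iq)`. [folklore] -/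
theorem hasDerivAt_w (p q x : ℝ) :
    HasDerivAt (fun x : ℝ => (1 : ℂ) - ((p : ℂ) + (q : ℂ) * I) * (x : ℂ))
      (-((p : ℂ) + (q : ℂ) * I)) x := by
  have h1 : HasDerivAt (fun x : ℝ => (x : ℂ)) 1 x := Complex.ofRealCLM.hasDerivAt
  have h2 := (h1.const_mul ((p : ℂ) + (q : ℂ) * I)).const_sub 1
  simpa using h2

/-- `d/dx log w(x) = −(p+iq)/w(x)` on the slit condition. [folklore] -/
theorem hasDerivAt_log_w {x : ℝ} (h : 0 < 1 - p * x ∨ q * x ≠ 0) :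
    HasDerivAt (fun x : ℝ => Complex.log ((1 : ℂ) - ((p : ℂ) + (q : ℂ) * I) * (x : ℂ)))
      (-((p : ℂ) + (q : ℂ) * I) / ((1 : ℂ) - ((p : ℂ) + (q : ℂ) * I) * (x : ℂ))) x :=
  (hasDerivAt_w p q x).clog_real (w_mem_slitPlane h)

/-- The logarithmic derivative `−(p+iq)/w(x) = ((−p + (p²+q²)x) − iq)/m(x)`. [folklore] -/
theorem neg_nu_div_w_eq {x : ℝ} (h : 0 < 1 - p * x ∨ q * x ≠ 0) :
    -((p : ℂ) + (q : ℂ) * I) / ((1 : ℂ) - ((p : ℂ) + (q : ℂ) * I) * (x : ℂ)) =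
      (((-p + (p ^ 2 + q ^ 2) * x : ℝ) : ℂ) + ((-q : ℝ) : ℂ) * I) *
        ((((1 - p * x) ^ 2 + (q * x) ^ 2)⁻¹ : ℝ) : ℂ) := by
  have hw := w_ne_zero h
  have hm := (m_pos h).ne'
  have key : (((-p + (p ^ 2 + q ^ 2) * x : ℝ) : ℂ) + ((-q : ℝ) : ℂ) * I) *
      ((1 : ℂ) - ((p : ℂ) + (q : ℂ) * I) * (x : ℂ)) =
      -((p : ℂ) + (q : ℂ) * I) * (((1 - p * x) ^ 2 + (q * x) ^ 2 : ℝ) : ℂ) := by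
    set a' : ℝ := -p + (p ^ 2 + q ^ 2) * x with ha'
    set m : ℝ := (1 - p * x) ^ 2 + (q * x) ^ 2 with hm_def
    apply Complex.ext
    · simp
      rw [ha', hm_def]
      ring
    · simp
      rw [ha', hm_def]
      ring
  rw [div_eq_iff hw]
  calc -((p : ℂ) + (q : ℂ) * I)
        = -((p : ℂ) + (q : ℂ) * I) * (((1 - p * x) ^ 2 + (q * x) ^ 2 : ℝ) : ℂ) *
            ((((1 - p * x) ^ 2 + (q * x) ^ 2)⁻¹ : ℝ) : ℂ) := by
          rw [Complex.ofReal_inv, mul_assoc, mul_inv_cancel₀ (by exact_mod_cast hm), mul_one]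
    _ = _ := by rw [← key]; ring

/-- Real part of the logarithmic derivative: `m'/(2m)`. [folklore] -/
theorem re_neg_nu_div_w {x : ℝ} (h : 0 < 1 - p * x ∨ q * x ≠ 0) :
    (-((p : ℂ) + (q : ℂ) * I) / ((1 : ℂ) - ((p : ℂ) + (q : ℂ) * I) * (x : ℂ))).re =
      (-p + (p ^ 2 + q ^ 2) * x) / ((1 - p * x) ^ 2 + (q * x) ^ 2) := by
  rw [neg_nu_div_w_eq h, Complex.re_mul_ofReal]
  set a' : ℝ := -p + (p ^ 2 + q ^ 2) * x with ha'
  simp [div_eq_mul_inv]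

/-- Imaginary part of the logarithmic derivative: `−q/m` (the derivative of `arg w`). [folklore] -/
theorem im_neg_nu_div_w {x : ℝ} (h : 0 < 1 - p * x ∨ q * x ≠ 0) :
    (-((p : ℂ) + (q : ℂ) * I) / ((1 : ℂ) - ((p : ℂ) + (q : ℂ) * I) * (x : ℂ))).im =
      -q / ((1 - p * x) ^ 2 + (q * x) ^ 2) := by
  rw [neg_nu_div_w_eq h, Complex.im_mul_ofReal]
  set a' : ℝ := -p + (p ^ 2 + q ^ 2) * x with ha'
  simp [div_eq_mul_inv]

/-- **The real simple-pole term.** `Re((γ + iδ)·(−(p+iq)/w(x))) = (γ(−p + (p²+q²)x) + δq)/m(x)`.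
[folklore] -/
theorem re_residue_term (γ δ : ℝ) {x : ℝ} (h : 0 < 1 - p * x ∨ q * x ≠ 0) :
    (((γ : ℂ) + (δ : ℂ) * I) *
        (-((p : ℂ) + (q : ℂ) * I) / ((1 : ℂ) - ((p : ℂ) + (q : ℂ) * I) * (x : ℂ)))).re =
      (γ * (-p + (p ^ 2 + q ^ 2) * x) + δ * q) / ((1 - p * x) ^ 2 + (q * x) ^ 2) := by
  rw [Complex.mul_re, re_neg_nu_div_w h, im_neg_nu_div_w h]
  simp
  ring

/-- The derivative of `arg w(x)` is the imaginary part of the logarithmic derivative. [folklore] -/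
theorem hasDerivAt_arg_w {x : ℝ} (h : 0 < 1 - p * x ∨ q * x ≠ 0) :
    HasDerivAt (fun x : ℝ => Complex.arg ((1 : ℂ) - ((p : ℂ) + (q : ℂ) * I) * (x : ℂ)))
      (-q / ((1 - p * x) ^ 2 + (q * x) ^ 2)) x := by
  have h1 := Complex.imCLM.hasFDerivAt.comp_hasDerivAt x (hasDerivAt_log_w h)
  rw [← im_neg_nu_div_w h]
  refine h1.congr_of_eventuallyEq ?_
  filter_upwards with y
  simp [Complex.log_im]

/-- `log (conj w) = conj (log w)` on the slit condition. [folklore] -/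
theorem log_conj_w {x : ℝ} (h : 0 < 1 - p * x ∨ q * x ≠ 0) :
    Complex.log (conj ((1 : ℂ) - ((p : ℂ) + (q : ℂ) * I) * (x : ℂ))) =
      conj (Complex.log ((1 : ℂ) - ((p : ℂ) + (q : ℂ) * I) * (x : ℂ))) := by
  rw [Complex.log_conj _ (mem_slitPlane_iff_arg.mp (w_mem_slitPlane h)).1]

/-- `w(x)` is algebraic when `p, q, x` are. [folklore] -/
theorem isAlgebraic_w {x : ℝ} (hp : IsAlgebraic ℚ p) (hq : IsAlgebraic ℚ q) (hx : IsAlgebraic ℚ x) :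
    IsAlgebraic ℚ ((1 : ℂ) - ((p : ℂ) + (q : ℂ) * I) * (x : ℂ)) := by
  have hI : IsAlgebraic ℚ Complex.I := by
    refine ⟨Polynomial.X ^ 2 + 1, ?_, ?_⟩
    · exact Polynomial.Monic.ne_zero (by monicity!)
    · simp
  exact isAlgebraic_one.sub ((hp.algebraMap.add (hq.algebraMap.mul hI)).mul hx.algebraMap)

/-- A complex number `γ + iδ` with real algebraic `γ, δ` is algebraic. [folklore] -/
theorem isAlgebraic_ofReal_add_ofReal_mul_I {γ δ : ℝ} (hγ : IsAlgebraic ℚ γ) (hδ : IsAlgebraic ℚ δ) :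
    IsAlgebraic ℚ ((γ : ℂ) + (δ : ℂ) * I) := by
  have hI : IsAlgebraic ℚ Complex.I := by
    refine ⟨Polynomial.X ^ 2 + 1, ?_, ?_⟩
    · exact Polynomial.Monic.ne_zero (by monicity!)
    · simp
  exact hγ.algebraMap.add (hδ.algebraMap.mul hI)

/-- Complex conjugation flips the sign of `q`: `conj w_{p,q}(x) = w_{p,−q}(x)`. [folklore] -/
theorem conj_w (p q x : ℝ) :
    conj ((1 : ℂ) - ((p : ℂ) + (q : ℂ) * I) * (x : ℂ)) =
      (1 : ℂ) - ((p : ℂ) + ((-q : ℝ) : ℂ) * I) * (x : ℂ) := by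
  apply Complex.ext <;> simp

/-- Complex conjugation of a residue: `conj (γ + iδ) = γ + i(−δ)`. [folklore] -/
theorem conj_ofReal_add_ofReal_mul_I (γ δ : ℝ) :
    conj ((γ : ℂ) + (δ : ℂ) * I) = (γ : ℂ) + ((-δ : ℝ) : ℂ) * I := by
  apply Complex.ext <;> simp

/-! ### The squared modulus as a positive Nash base -/

/-- Derivative of the squared modulus: `m' = 2(−p + (p²+q²)x)`. [folklore] -/
theorem hasDerivAt_m (p q x : ℝ) :
    HasDerivAt (fun x => (1 - p * x) ^ 2 + (q * x) ^ 2) (2 * (-p + (p ^ 2 + q ^ 2) * x)) x := by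
  have h1 : HasDerivAt (fun x => 1 - p * x) (-p) x := by
    simpa using ((hasDerivAt_id x).const_mul p).const_sub 1
  have h2 : HasDerivAt (fun x => q * x) q x := by simpa using (hasDerivAt_id x).const_mul q
  have h := (h1.mul h1).add (h2.mul h2)
  have hfun : (fun x => (1 - p * x) ^ 2 + (q * x) ^ 2) =
      fun x => (1 - p * x) * (1 - p * x) + q * x * (q * x) := by
    funext y; ring
  rw [hfun]
  exact h.congr_deriv (by ring)

/-- The squared modulus is `ℚ`-semialgebraic when `p, q` are algebraic.
[cite: KontsevichZagier2001, §1.2] -/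
theorem isSemialgebraicFunOn_m {a b : ℝ} (hI : IsSemialgebraic ℚ {t : Fin 1 → ℝ | t 0 ∈ Ioo a b})
    (hp : IsAlgebraic ℚ p) (hq : IsAlgebraic ℚ q) :
    IsSemialgebraicFunOn ℚ {t : Fin 1 → ℝ | t 0 ∈ Ioo a b}
      (fun t => (1 - p * t 0) ^ 2 + (q * t 0) ^ 2) := by
  have hx : IsSemialgebraicFunOn ℚ {t : Fin 1 → ℝ | t 0 ∈ Ioo a b} (fun t => t 0) := by
    simpa using isSemialgebraicFunOn_aeval hI (X 0 : MvPolynomial (Fin 1) ℚ)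
  have h1 : IsSemialgebraicFunOn ℚ {t : Fin 1 → ℝ | t 0 ∈ Ioo a b} (fun _ => (1:ℝ)) := by
    simpa using isSemialgebraicFunOn_const_natCast hI 1
  have hA : IsSemialgebraicFunOn ℚ {t : Fin 1 → ℝ | t 0 ∈ Ioo a b} (fun t => 1 - p * t 0) :=
    h1.fun_sub ((isSemialgebraicFunOn_const_of_isAlgebraic hI hp).fun_mul hx)
  have hB : IsSemialgebraicFunOn ℚ {t : Fin 1 → ℝ | t 0 ∈ Ioo a b} (fun t => q * t 0) :=
    (isSemialgebraicFunOn_const_of_isAlgebraic hI hq).fun_mul hx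
  exact ((hA.fun_mul hA).fun_add (hB.fun_mul hB)).congr fun _ _ => by ring

/-- Real part `1 − p x` as a semialgebraic function. [cite: KontsevichZagier2001, §1.2] -/
theorem isSemialgebraicFunOn_w_re {a b : ℝ} (hI : IsSemialgebraic ℚ {t : Fin 1 → ℝ | t 0 ∈ Ioo a b})
    (hp : IsAlgebraic ℚ p) :
    IsSemialgebraicFunOn ℚ {t : Fin 1 → ℝ | t 0 ∈ Ioo a b}
      (fun t => ((1 : ℂ) - ((p : ℂ) + (q : ℂ) * I) * ((t 0 : ℝ) : ℂ)).re) := by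
  have hx : IsSemialgebraicFunOn ℚ {t : Fin 1 → ℝ | t 0 ∈ Ioo a b} (fun t => t 0) := by
    simpa using isSemialgebraicFunOn_aeval hI (X 0 : MvPolynomial (Fin 1) ℚ)
  have h1 : IsSemialgebraicFunOn ℚ {t : Fin 1 → ℝ | t 0 ∈ Ioo a b} (fun _ => (1:ℝ)) := by
    simpa using isSemialgebraicFunOn_const_natCast hI 1
  exact (h1.fun_sub ((isSemialgebraicFunOn_const_of_isAlgebraic hI hp).fun_mul hx)).congr
    fun t _ => by rw [w_re]

/-- Imaginary part `−q x` as a semialgebraic function. [cite: KontsevichZagier2001, §1.2] -/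
theorem isSemialgebraicFunOn_w_im {a b : ℝ} (hI : IsSemialgebraic ℚ {t : Fin 1 → ℝ | t 0 ∈ Ioo a b})
    (hq : IsAlgebraic ℚ q) :
    IsSemialgebraicFunOn ℚ {t : Fin 1 → ℝ | t 0 ∈ Ioo a b}
      (fun t => ((1 : ℂ) - ((p : ℂ) + (q : ℂ) * I) * ((t 0 : ℝ) : ℂ)).im) := by
  have hx : IsSemialgebraicFunOn ℚ {t : Fin 1 → ℝ | t 0 ∈ Ioo a b} (fun t => t 0) := by
    simpa using isSemialgebraicFunOn_aeval hI (X 0 : MvPolynomial (Fin 1) ℚ)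
  exact ((isSemialgebraicFunOn_const_of_isAlgebraic hI hq).fun_mul hx).neg.congr
    fun t _ => by rw [w_im]; rfl

/-- Real part of `w` is real-analytic in `x`. [folklore] -/
theorem analyticAt_w_re (p q x : ℝ) :
    AnalyticAt ℝ (fun x : ℝ => ((1 : ℂ) - ((p : ℂ) + (q : ℂ) * I) * (x : ℂ)).re) x := by
  have : (fun x : ℝ => ((1 : ℂ) - ((p : ℂ) + (q : ℂ) * I) * (x : ℂ)).re) = fun x => 1 - p * x :=
    funext fun x => w_re p q x
  rw [this]
  exact analyticAt_const.sub (analyticAt_const.mul analyticAt_id)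

/-- Imaginary part of `w` is real-analytic in `x`. [folklore] -/
theorem analyticAt_w_im (p q x : ℝ) :
    AnalyticAt ℝ (fun x : ℝ => ((1 : ℂ) - ((p : ℂ) + (q : ℂ) * I) * (x : ℂ)).im) x := by
  have : (fun x : ℝ => ((1 : ℂ) - ((p : ℂ) + (q : ℂ) * I) * (x : ℂ)).im) = fun x => -(q * x) :=
    funext fun x => w_im p q x
  rw [this]
  exact (analyticAt_const.mul analyticAt_id).neg

end KZ.BakerSectorComplex

end Literature.NumberTheory.Transcendental
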